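import Literature.MathematicalPhysics.QuantumFieldTheory.BorinskyMunchTellander2023.KinematicRegimes
import Literature.MathematicalPhysics.QuantumFieldTheory.SecondSymanzikFactorization
import HarnessLib

/-!
# BMT23's own mass-momentum-spanning predicate `ℱ_{G/γ} = 0` for Gram-matrix kinematics, its agreement with the combinatorial one under generic kinematics, and Theorems 3.6 / 3.9 with the LITERAL `z_ℱ` — PROVED

**Source.** M. Borinsky, H. J. Munch, F. Tellander, *Tropical Feynman integration in the Minkowski regime*, Comput. Phys.
Commun. 292 (2023) 108874, arXiv:2302.08955 [cite: BorinskyMunchTellander2023] — §3.3 (l.715–717 of `main.tex`): "We use the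
following slightly generalized version of Brown's definition (see also [Borinsky 2020, Sec. 7.2]): We call a subgraph γ ⊂ E
mass-momentum spanning if the second Symanzik polynomial of the cograph G/γ vanishes identically ℱ_{G/γ} = 0."; THEOREM 3.5
(l.740–748: "z_ℱ(γ) = L_γ + 1 if γ is mass-momentum spanning and z_ℱ(γ) = L_γ otherwise"); THEOREM 3.6 (l.766–779: "Theorem 3.5
holds in all regimes if the kinematics are generic. *Proof.* The ℱ polynomial has the same monomials (with different coefficients) as
in the Euclidean regime with generic kinematics. To verify this, note that the conditions for generic kinematics prevent cancellations
between the mass and momentum part of the ℱ polynomial as given in eq. (polyUF). So, the respective Newton polytopes coincide.");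
THEOREM 3.9 (l.855–859: "Even if N[ℱ] ≠ P[z_ℱ], the Newton polytope N[ℱ] is *bounded* by the base polytope P[z_ℱ]. The reason for
this is that ℱ can only lose monomials if we make the kinematics less generic. Theorem 3.9. We have N[ℱ] ⊂ P[z_ℱ]."). Brown 2017
(arXiv:1512.06409) eq. (2.5) "For generic kinematics … γ is m.m. ⟺ Ξ_{G/γ}(q,m) = 0" and Thm 2.7 (`Ξ_G = Ψ_γ Ξ_{G/γ} + R^{Ξ,UV}`,
"R^{Ξ,UV}_{γ,G}(q,m) has degree > h_γ in the α_e, e ∈ E_γ") supply the mechanism [cite: Brown2017].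

**Why this file.** The companion `KinematicRegimes.lean` typed §2.2 and Theorems 3.6 / 3.9 for kinematics given by a symmetric matrix
`𝒫` with vanishing row sums, with "mass-momentum spanning" in the COMBINATORIAL reading (`IsMassMomentumSpanningGram`: all massive
edges in `γ`, all external vertices joined by `γ`) and disclosed that BMT23's own predicate is "ℱ_{G/γ} = 0". This file types that
predicate for `𝒫`-kinematics and removes the reading: (1) `gramSecondSymanzikQuot E γ P m` = `ℱ_{G/γ}` built by eq. (polyUF) from
`𝒫` on the quotient (in the matroid form of the companion `SecondSymanzikFactorization.lean`: spanning 2-forests of `G/γ` =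
independent sets `T'` of `M(G)/γ` in `E∖γ` with `|T'| = |V| − 2 − rk γ`, their squared momentum read off `𝒫` on one side of `γ ∪ T'`
in `G`); (2) `zBMT E P m γ = L_γ + [ℱ_{G/γ} = 0]` — THE printed `z_ℱ`; (3) **`isMassMomentumSpanningGram_iff_gramSecondSymanzikQuot_eq_zero`**:
under (generic kinematics) on a connected graph BMT23's predicate IS the combinatorial one (Brown eq. (2.5) for `𝒫`), and for every
symmetric conserved `𝒫` the combinatorial one implies it (`gramSecondSymanzikQuot_eq_zero_of_isMassMomentumSpanningGram`,
`zGram_le_zBMT`); (4) **THEOREM 3.6 with the literal `z_ℱ`** (`newtonPolytope_gramSecondSymanzik_eq_gpPolytope_zBMT`, via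
`zBMT_eq_zGram` and the companion); (5) **THEOREM 3.9 with the literal `z_ℱ` for EVERY symmetric conserved `𝒫` — exceptional kinematics
included** (`newtonPolytope_gramSecondSymanzik_subset_gpPolytope_zBMT`), which REFINES the companion's inclusion
(`gpPolytope_zBMT_subset_gpPolytope_zGram`). The proof of (5) is the coefficient-level content of Brown's UV factorisation for
`𝒫`-kinematics: every monomial of `ℱ_G(𝒫)` is a monomial of the Euclidean generic `Ξ_G(p̃)` (companion), i.e. `x^{𝟙_{E∖F}}` for a
spanning 2-forest `F` or `x_e x^{𝟙_{E∖T}}` for a spanning tree `T` and a massive `e`; such a monomial has `≥ L_γ` variables of `γ`,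
with equality only when `|F ∩ γ| = rk γ` (resp. `|T ∩ γ| = rk γ`, `e ∉ γ`), and then its coefficient IS a coefficient of `ℱ_{G/γ}(𝒫)`
(`coeff_gramSecondSymanzik_eq_coeff_quot`: same root side — "the kinematics of G/γ are inherited from G" —, same cut, Lemma 2.1's
`F ↦ F ∖ γ`; `coeff_quotTwoForestPolynomial_base_add_single` for the mass monomial), so "ℱ_{G/γ} = 0" forces `≥ L_γ + 1`
(`loopNumber_add_one_le_gammaDeg`).

**Readings kept (disclosed).** Kinematics = `P : Matrix (Fin (V+1)) (Fin (V+1)) ℝ` with `P.IsSymm`, `∀ u, Σ_v P u v = 0` (§2.2,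
l.329–332); `V'` non-empty proper in (generic kinematics) (companion `IsGeneric`); the quotient's kinematics: each vertex of `G/γ` (a
component of `γ`) carries the momenta of its vertices, so the squared momentum across a 2-forest `T'` of `G/γ` is `Σ_{u,v∈V'}
𝒫^{u,v}` over one side `V'` of `γ ∪ T'` in `G` (Brown §1.4 / Schultka §4 "inherited from G in the obvious way"; the companion's
reading for vector momenta); `P[z]` = the tree's facet presentation `gpPolytope`; masses real.

**What is NOT said here.** No statement that `N[ℱ] = P[z_ℱ]` for exceptional kinematics (BMT23 Conjecture 3.7 / Observation 3.8 and
the printed counterexamples — not typed); `z_ℱ` need not be supermodular for exceptional kinematics (BMT23 after Conjecture 3.7) —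
`supermodular_zBMT` carries the genericity hypothesis; nothing on §4–§6 of BMT23. D-0026: 0 new named facts; every statement proved;
helpers inline (private plumbing duplicated from the companions, which keep theirs private).
-/

noncomputable section

namespace Literature.MathematicalPhysics.QuantumFieldTheory.BorinskyMunchTellander2023

open Finset MvPolynomial Matrix Matroid
open Literature.MathematicalPhysics.QuantumFieldTheory
open Literature.MathematicalPhysics.QuantumFieldTheory.Borinsky2020

variable {N V : ℕ} (E : Fin N → Fin (V + 1) × Fin (V + 1))

/-! ## Part 1 — `ℱ_{G/γ}` from `𝒫`: the quotient's second Symanzik polynomial in the shape of the companion's `Ξ_{G/γ}` -/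

section Definitions

variable {W : Type*} [NormedAddCommGroup W]

open scoped Classical in
/-- The common shape of the companion's `Ξ_{G/γ}(q,m)` (`secondSymanzikQuot`, Brown Thm 2.7 / Borinsky §7.1 / BMT23 §3.3's `ℱ_{G/γ}`)
for an arbitrary real coefficient `c(T')` on the spanning 2-forests `T'` of `G/γ` (independent sets of the contraction `M(G)/γ`
inside `E ∖ γ` with `|T'| = |V_G| − 2 − rk γ`) plus the quotient's mass term `Ψ_{G/γ} · Σ_{e∉γ} m_e² x_e`.
[cite: BorinskyMunchTellander2023, §3.3 (main.tex l.715–717) with §2.1 eq. (polyUF); Brown2017, Thm 2.7 eq. (XiUVfact)] -/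
def quotTwoForestPolynomial (γ : Finset (Fin N)) (c : Finset (Fin N) → ℝ) (m : Fin N → ℝ) : MvPolynomial (Fin N) ℝ :=
  (∑ T' ∈ γᶜ.powerset.filter (fun T' : Finset (Fin N) =>
      ((cycleMatroid E) ／ (↑γ : Set (Fin N))).Indep (↑T' : Set (Fin N)) ∧ T'.card + 2 + edgeRank E γ = V + 1),
      c T' • ∏ e ∈ γᶜ \ T', X e) +
    kirchhoffQuot E γ * ∑ e ∈ γᶜ, m e ^ 2 • X e

/-- The companion's `Ξ_{G/γ}(q,m)` is this shape with `c(T') = ‖p(γ ∪ T')‖²`. [cite: Brown2017, Thm 2.7 eq. (XiUVfact); Borinsky2020, §7.1 (tropical.tex l.1195)] -/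
theorem secondSymanzikQuot_eq_quotTwoForestPolynomial (γ : Finset (Fin N)) (p : Fin (V + 1) → W) (m : Fin N → ℝ) :
    secondSymanzikQuot E γ p m = quotTwoForestPolynomial E γ (fun T' => ‖momentumFlow E (γ ∪ T') p‖ ^ 2) m := rfl

/-- **`ℱ_{G/γ}` read off `𝒫`** — "We call a subgraph γ ⊂ E mass-momentum spanning if the second Symanzik polynomial of the cograph
G/γ vanishes identically ℱ_{G/γ} = 0": eq. (polyUF) for the quotient, the squared momentum between the two components of a
spanning 2-forest `T'` of `G/γ` being `Σ_{u,v∈V'} 𝒫^{u,v}` over one side `V'` of the edge set `γ ∪ T'` in `G` (each vertex of `G/γ` —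
a component of `γ` — carries the momenta of its vertices; the companion's reading of "the kinematics of G/γ"), masses those of
`E ∖ γ`. [cite: BorinskyMunchTellander2023, §3.3 (main.tex l.715–717), §2.1 eq. (polyUF) (l.304–305); Brown2017, §1.4 (quotient kinematics)] -/
def gramSecondSymanzikQuot (γ : Finset (Fin N)) (P : Matrix (Fin (V + 1)) (Fin (V + 1)) ℝ) (m : Fin N → ℝ) :
    MvPolynomial (Fin N) ℝ :=
  quotTwoForestPolynomial E γ (fun T' => -sqMomentum P (rootSide E (γ ∪ T'))) m

open scoped Classical in
/-- The cut of a spanning 2-forest `T'` of `G/γ`: the edges `e ∉ γ ∪ T'` such that `T' + e` is a spanning tree of `G/γ` (a base of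
`M(G)/γ`) — the index set of the quotient's mass monomials meeting the 2-forest monomial of `T'`.
[cite: BorinskyMunchTellander2023, §2.1 eq. (polyUF) and §2.2 (main.tex l.391–392); Oxley2011, §3.1 Prop. 3.1.7 (bases of a contraction)] -/
def quotCutEdges (γ T' : Finset (Fin N)) : Finset (Fin N) :=
  γᶜ.filter fun e => e ∉ T' ∧ ((cycleMatroid E) ／ (↑γ : Set (Fin N))).IsBase (↑(insert e T') : Set (Fin N))

open scoped Classical in
/-- **BMT23's `z_ℱ` LITERALLY: `z_ℱ(γ) = L_γ + 1` if `ℱ_{G/γ} = 0` and `z_ℱ(γ) = L_γ` otherwise** — Theorem 3.5's boolean function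
with mass-momentum spanning in the paper's OWN sense ("the second Symanzik polynomial of the cograph G/γ vanishes identically
ℱ_{G/γ} = 0"), for `𝒫`-kinematics. Under generic kinematics it is the companion's `zGram` (`zBMT_eq_zGram`); for exceptional
kinematics it can exceed it. [cite: BorinskyMunchTellander2023, Theorem 3.5 (main.tex l.740–746) with §3.3 (l.715–717)] -/
def zBMT (P : Matrix (Fin (V + 1)) (Fin (V + 1)) ℝ) (m : Fin N → ℝ) (γ : Finset (Fin N)) : ℝ :=
  loopNumber E γ + if gramSecondSymanzikQuot E γ P m = 0 then 1 else 0

end Definitions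

/-! ## Part 2 — the monomials of the quotient shape: `[x^{𝟙_{(E∖γ)∖T'}}] = c(T') + Σ_{e ∈ cut_γ(T')} m_e²`, `[x^{𝟙_{(E∖γ)∖B} + 𝟙_e}] = m_e²` -/

section Support

variable {E}

/-- A square-free product of variables is the monomial of its exponent vector. Plumbing. [folklore] -/
private theorem prod_X_eq_monomial (S : Finset (Fin N)) :
    ∏ e ∈ S, (X e : MvPolynomial (Fin N) ℝ) = monomial (∑ e' ∈ S, Finsupp.single e' 1) 1 := by
  classical
  induction S using Finset.induction_on with
  | empty => simp
  | insert e S he ih =>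
    rw [Finset.prod_insert he, Finset.sum_insert he, ih, ← pow_one (X e), X_pow_eq_monomial,
      monomial_mul, one_mul]

/-- `(Σ_{e'∈S} 𝟙_{e'})(k) = [k ∈ S]`. Plumbing. [folklore] -/
private theorem sum_single_apply (S : Finset (Fin N)) (k : Fin N) :
    (∑ e' ∈ S, Finsupp.single e' (1 : ℕ) : Fin N →₀ ℕ) k = if k ∈ S then 1 else 0 := by
  classical
  rw [Finsupp.coe_finsetSum, Finset.sum_apply]
  simp [Finsupp.single_apply]

/-- The support of `Σ_{e∈S} 𝟙_e` is `S`. Plumbing. [folklore] -/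
private theorem support_sum_single (S : Finset (Fin N)) :
    (∑ e' ∈ S, Finsupp.single e' (1 : ℕ) : Fin N →₀ ℕ).support = S := by
  classical
  ext k
  rw [Finsupp.mem_support_iff, sum_single_apply]
  simp

/-- `S ↦ Σ_{e∈S} 𝟙_e` is injective. Plumbing. [folklore] -/
private theorem sum_single_injective {S T : Finset (Fin N)}
    (h : (∑ e' ∈ S, Finsupp.single e' (1 : ℕ) : Fin N →₀ ℕ) = ∑ e' ∈ T, Finsupp.single e' 1) : S = T := by
  have := congrArg Finsupp.support h
  rwa [support_sum_single, support_sum_single] at this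

/-- Inside `E ∖ γ`: `𝟙_{(E∖γ)∖B} + 𝟙_e = 𝟙_{(E∖γ)∖T'}` iff `e ∉ T'` and `B = T' + e` (`B, T' ⊆ E∖γ`, `e ∉ γ`). Plumbing. [folklore] -/
private theorem sdiff_add_single_eq_iff {γ B T' : Finset (Fin N)} {e : Fin N} (hB : B ⊆ γᶜ) (hT' : T' ⊆ γᶜ) (he : e ∈ γᶜ) :
    ∑ e' ∈ γᶜ \ B, Finsupp.single e' (1 : ℕ) + Finsupp.single e 1 = ∑ e' ∈ γᶜ \ T', Finsupp.single e' 1 ↔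
      e ∉ T' ∧ B = insert e T' := by
  classical
  constructor
  · intro h
    have hk : ∀ k, (if k ∈ γᶜ \ B then 1 else 0) + (if e = k then 1 else 0) = (if k ∈ γᶜ \ T' then (1 : ℕ) else 0) := by
      intro k
      have := DFunLike.congr_fun h k
      rwa [Finsupp.add_apply, sum_single_apply, sum_single_apply, Finsupp.single_apply] at this
    have hke := hk e
    rw [if_pos rfl] at hke
    have heB : e ∈ B := by
      by_contra heB
      rw [if_pos (Finset.mem_sdiff.2 ⟨he, heB⟩)] at hke
      by_cases h' : e ∈ γᶜ \ T'
      · rw [if_pos h'] at hke; omega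
      · rw [if_neg h'] at hke; omega
    have heT : e ∉ T' := by
      intro heT
      rw [if_neg (fun h => (Finset.mem_sdiff.1 h).2 heT)] at hke
      by_cases h' : e ∈ γᶜ \ B
      · rw [if_pos h'] at hke; omega
      · rw [if_neg h'] at hke; omega
    refine ⟨heT, ?_⟩
    ext k
    rw [Finset.mem_insert]
    by_cases hke' : k = e
    · subst hke'
      simp [heB]
    · have h' := hk k
      rw [if_neg (Ne.symm hke'), add_zero] at h'
      constructor
      · intro hkB
        right
        by_contra hkT
        rw [if_neg (fun h => (Finset.mem_sdiff.1 h).2 hkB), if_pos (Finset.mem_sdiff.2 ⟨hB hkB, hkT⟩)] at h'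
        omega
      · rintro (h1 | hkT)
        · exact absurd h1 hke'
        · by_contra hkB
          rw [if_pos (Finset.mem_sdiff.2 ⟨hT' hkT, hkB⟩), if_neg (fun h => (Finset.mem_sdiff.1 h).2 hkT)] at h'
          omega
  · rintro ⟨heT, rfl⟩
    ext k
    rw [Finsupp.add_apply, sum_single_apply, sum_single_apply, Finsupp.single_apply]
    by_cases hke' : e = k
    · subst hke'
      rw [if_neg (fun h => (Finset.mem_sdiff.1 h).2 (Finset.mem_insert_self e T')), if_pos rfl,
        if_pos (Finset.mem_sdiff.2 ⟨he, heT⟩)]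
    · rw [if_neg hke', add_zero]
      have : k ∈ γᶜ \ insert e T' ↔ k ∈ γᶜ \ T' := by
        rw [Finset.mem_sdiff, Finset.mem_sdiff, Finset.mem_insert, not_or]
        exact ⟨fun h => ⟨h.1, h.2.2⟩, fun h => ⟨h.1, fun h' => hke' h'.symm, h.2⟩⟩
      by_cases hk : k ∈ γᶜ \ T'
      · rw [if_pos (this.2 hk), if_pos hk]
      · rw [if_neg (fun h => hk (this.1 h)), if_neg hk]

/-- Inside `E ∖ γ`: the non-square-free exponent `𝟙_{(E∖γ)∖B} + 𝟙_e` (`e ∉ B`) determines the pair `(B, e)`. Plumbing. [folklore] -/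
private theorem sdiff_add_single_inj {γ B B' : Finset (Fin N)} {e e' : Fin N} (hB : B ⊆ γᶜ) (hB' : B' ⊆ γᶜ) (he : e ∈ γᶜ)
    (heB : e ∉ B)
    (h : ∑ x ∈ γᶜ \ B', Finsupp.single x (1 : ℕ) + Finsupp.single e' 1 = ∑ x ∈ γᶜ \ B, Finsupp.single x 1 + Finsupp.single e 1) :
    B' = B ∧ e' = e := by
  classical
  have hk : ∀ k, (if k ∈ γᶜ \ B' then 1 else 0) + (if e' = k then 1 else 0) =
      (if k ∈ γᶜ \ B then (1 : ℕ) else 0) + (if e = k then 1 else 0) := by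
    intro k
    have := DFunLike.congr_fun h k
    rwa [Finsupp.add_apply, Finsupp.add_apply, sum_single_apply, sum_single_apply, Finsupp.single_apply,
      Finsupp.single_apply] at this
  have hee : e' = e := by
    have hke := hk e
    rw [if_pos (Finset.mem_sdiff.2 ⟨he, heB⟩), if_pos rfl] at hke
    by_contra hne
    rw [if_neg hne] at hke
    by_cases h' : e ∈ γᶜ \ B'
    · rw [if_pos h'] at hke; omega
    · rw [if_neg h'] at hke; omega
  subst hee
  refine ⟨?_, rfl⟩
  ext k
  have h' := hk k
  have h'' : (if k ∈ γᶜ \ B' then 1 else 0) = (if k ∈ γᶜ \ B then (1 : ℕ) else 0) := by omega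
  by_cases hk1 : k ∈ γᶜ \ B' <;> by_cases hk2 : k ∈ γᶜ \ B
  · rw [Finset.mem_sdiff] at hk1 hk2
    exact ⟨fun h => absurd h hk1.2, fun h => absurd h hk2.2⟩
  · rw [if_pos hk1, if_neg hk2] at h''; omega
  · rw [if_neg hk1, if_pos hk2] at h''; omega
  · rw [Finset.mem_sdiff, not_and, not_not] at hk1 hk2
    by_cases hkγ : k ∈ γᶜ
    · exact ⟨fun _ => hk2 hkγ, fun _ => hk1 hkγ⟩
    · exact ⟨fun h => absurd (hB' h) hkγ, fun h => absurd (hB h) hkγ⟩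

/-- A square-free exponent is never of the form `𝟙_{(E∖γ)∖B} + 𝟙_e` with `e ∈ (E∖γ)∖B` (value `2` at `e`). Plumbing. [folklore] -/
private theorem sdiff_ne_sdiff_add_single {γ B T' : Finset (Fin N)} {e : Fin N} (he : e ∈ γᶜ) (heB : e ∉ B) :
    ∑ x ∈ γᶜ \ T', Finsupp.single x (1 : ℕ) ≠ ∑ x ∈ γᶜ \ B, Finsupp.single x 1 + Finsupp.single e 1 := by
  classical
  intro h
  have := DFunLike.congr_fun h e
  rw [Finsupp.add_apply, sum_single_apply, sum_single_apply, Finsupp.single_apply, if_pos rfl,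
    if_pos (Finset.mem_sdiff.2 ⟨he, heB⟩)] at this
  by_cases h' : e ∈ γᶜ \ T'
  · rw [if_pos h'] at this; omega
  · rw [if_neg h'] at this; omega

open scoped Classical in
/-- The quotient shape as a sum of monomials (`Ψ_{G/γ} = Σ_B x^{𝟙_{(E∖γ)∖B}}` over the bases `B` of `M(G)/γ`).
[cite: BorinskyMunchTellander2023, §2.1 eq. (polyUF) with §3.3; Brown2017, Thm 2.7] -/
theorem quotTwoForestPolynomial_eq_sum_monomial (γ : Finset (Fin N)) (c : Finset (Fin N) → ℝ) (m : Fin N → ℝ) :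
    quotTwoForestPolynomial E γ c m =
      (∑ T' ∈ γᶜ.powerset.filter (fun T' : Finset (Fin N) =>
          ((cycleMatroid E) ／ (↑γ : Set (Fin N))).Indep (↑T' : Set (Fin N)) ∧ T'.card + 2 + edgeRank E γ = V + 1),
          c T' • monomial (∑ e' ∈ γᶜ \ T', Finsupp.single e' 1) (1 : ℝ)) +
        ∑ B ∈ γᶜ.powerset.filter
            (fun B : Finset (Fin N) => ((cycleMatroid E) ／ (↑γ : Set (Fin N))).IsBase (↑B : Set (Fin N))),
          ∑ e ∈ γᶜ, m e ^ 2 • monomial (∑ e' ∈ γᶜ \ B, Finsupp.single e' 1 + Finsupp.single e 1) (1 : ℝ) := by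
  unfold quotTwoForestPolynomial kirchhoffQuot
  congr 1
  · exact Finset.sum_congr rfl fun T' _ => by rw [prod_X_eq_monomial]
  · rw [Finset.sum_mul]
    refine Finset.sum_congr rfl fun B _ => ?_
    rw [prod_X_eq_monomial, Finset.mul_sum]
    refine Finset.sum_congr rfl fun e _ => ?_
    rw [mul_smul_comm, ← pow_one (X e), X_pow_eq_monomial, monomial_mul, one_mul]

open scoped Classical in
/-- The coefficients of the quotient shape. [cite: BorinskyMunchTellander2023, §2.1 eq. (polyUF) with §3.3; Brown2017, Thm 2.7] -/
theorem coeff_quotTwoForestPolynomial (γ : Finset (Fin N)) (c : Finset (Fin N) → ℝ) (m : Fin N → ℝ) (d : Fin N →₀ ℕ) :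
    coeff d (quotTwoForestPolynomial E γ c m) =
      (∑ T' ∈ γᶜ.powerset.filter (fun T' : Finset (Fin N) =>
          ((cycleMatroid E) ／ (↑γ : Set (Fin N))).Indep (↑T' : Set (Fin N)) ∧ T'.card + 2 + edgeRank E γ = V + 1),
          if ∑ e' ∈ γᶜ \ T', Finsupp.single e' 1 = d then c T' else 0) +
        ∑ B ∈ γᶜ.powerset.filter
            (fun B : Finset (Fin N) => ((cycleMatroid E) ／ (↑γ : Set (Fin N))).IsBase (↑B : Set (Fin N))),
          ∑ e ∈ γᶜ, if ∑ e' ∈ γᶜ \ B, Finsupp.single e' 1 + Finsupp.single e 1 = d then m e ^ 2 else 0 := by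
  rw [quotTwoForestPolynomial_eq_sum_monomial, coeff_add, coeff_sum, coeff_sum]
  congr 1
  · refine Finset.sum_congr rfl fun T' _ => ?_
    rw [coeff_smul, coeff_monomial, smul_eq_mul, mul_ite, mul_one, mul_zero]
  · refine Finset.sum_congr rfl fun B _ => ?_
    rw [coeff_sum]
    refine Finset.sum_congr rfl fun e _ => ?_
    rw [coeff_smul, coeff_monomial, smul_eq_mul, mul_ite, mul_one, mul_zero]

open scoped Classical in
/-- **The coefficient of `x^{𝟙_{(E∖γ)∖T'}}` at a spanning 2-forest `T'` of `G/γ` is `c(T') + Σ_{e ∈ cut_γ(T')} m_e²`** (the quotient's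
momentum and mass parts meet exactly there). [cite: BorinskyMunchTellander2023, §2.2 (main.tex l.391–392) with §2.1 eq. (polyUF) and §3.3] -/
theorem coeff_quotTwoForestPolynomial_quotTwoForest (γ : Finset (Fin N)) (c : Finset (Fin N) → ℝ) (m : Fin N → ℝ)
    {T' : Finset (Fin N)} (hT'γ : T' ⊆ γᶜ)
    (hT' : ((cycleMatroid E) ／ (↑γ : Set (Fin N))).Indep (↑T' : Set (Fin N)) ∧ T'.card + 2 + edgeRank E γ = V + 1) :
    coeff (∑ e' ∈ γᶜ \ T', Finsupp.single e' 1) (quotTwoForestPolynomial E γ c m) =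
      c T' + ∑ e ∈ quotCutEdges E γ T', m e ^ 2 := by
  rw [coeff_quotTwoForestPolynomial]
  congr 1
  · have h1 : ∀ T'' ∈ γᶜ.powerset.filter (fun T' : Finset (Fin N) =>
          ((cycleMatroid E) ／ (↑γ : Set (Fin N))).Indep (↑T' : Set (Fin N)) ∧ T'.card + 2 + edgeRank E γ = V + 1),
        (if ∑ e' ∈ γᶜ \ T'', Finsupp.single e' 1 = ∑ e' ∈ γᶜ \ T', Finsupp.single e' (1 : ℕ) then c T'' else 0) =
          if T'' = T' then c T'' else 0 := fun T'' hT'' => by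
      have hT''γ : T'' ⊆ γᶜ := Finset.mem_powerset.1 (Finset.mem_filter.1 hT'').1
      by_cases hTT : T'' = T'
      · rw [if_pos hTT, if_pos (by rw [hTT])]
      · rw [if_neg hTT, if_neg fun h => hTT ?_]
        have := sum_single_injective h
        rw [← Finset.sdiff_sdiff_eq_self hT''γ, this, Finset.sdiff_sdiff_eq_self hT'γ]
    rw [Finset.sum_congr rfl h1, Finset.sum_ite_eq',
      if_pos (Finset.mem_filter.2 ⟨Finset.mem_powerset.2 hT'γ, hT'⟩)]
  · rw [Finset.sum_comm]
    unfold quotCutEdges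
    rw [Finset.sum_filter]
    refine Finset.sum_congr rfl fun e he => ?_
    by_cases hcut : e ∉ T' ∧ ((cycleMatroid E) ／ (↑γ : Set (Fin N))).IsBase (↑(insert e T') : Set (Fin N))
    · rw [if_pos hcut]
      have hmem : insert e T' ∈ γᶜ.powerset.filter
          (fun B : Finset (Fin N) => ((cycleMatroid E) ／ (↑γ : Set (Fin N))).IsBase (↑B : Set (Fin N))) :=
        Finset.mem_filter.2 ⟨Finset.mem_powerset.2 (Finset.insert_subset he hT'γ), hcut.2⟩
      rw [Finset.sum_eq_single_of_mem (insert e T') hmem fun B hB hB' => if_neg fun h => hB' ?_]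
      · exact if_pos ((sdiff_add_single_eq_iff (Finset.insert_subset he hT'γ) hT'γ he).2 ⟨hcut.1, rfl⟩)
      · exact ((sdiff_add_single_eq_iff (Finset.mem_powerset.1 (Finset.mem_filter.1 hB).1) hT'γ he).1 h).2
    · rw [if_neg hcut]
      refine Finset.sum_eq_zero fun B hB => if_neg fun h => hcut ?_
      have hBγ : B ⊆ γᶜ := Finset.mem_powerset.1 (Finset.mem_filter.1 hB).1
      obtain ⟨heT, rfl⟩ := (sdiff_add_single_eq_iff hBγ hT'γ he).1 h
      exact ⟨heT, (Finset.mem_filter.1 hB).2⟩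

open scoped Classical in
/-- **The coefficient of the quotient's non-square-free mass monomial `x^{𝟙_{(E∖γ)∖B} + 𝟙_e}` (`B` a spanning tree of `G/γ`,
`e ∉ γ ∪ B`) is `m_e²`** — no 2-forest monomial and no other (tree, edge) pair has this exponent. [cite: BorinskyMunchTellander2023, §2.1 eq. (polyUF) with §3.3; Brown2017, Lemma 1.13 (proof: "the coefficient of α_e² in Ξ_G is m_e² Ψ_{G∖e}")] -/
theorem coeff_quotTwoForestPolynomial_base_add_single (γ : Finset (Fin N)) (c : Finset (Fin N) → ℝ) (m : Fin N → ℝ)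
    {B : Finset (Fin N)} (hBγ : B ⊆ γᶜ) (hB : ((cycleMatroid E) ／ (↑γ : Set (Fin N))).IsBase (↑B : Set (Fin N)))
    {e : Fin N} (he : e ∈ γᶜ) (heB : e ∉ B) :
    coeff (∑ e' ∈ γᶜ \ B, Finsupp.single e' 1 + Finsupp.single e 1) (quotTwoForestPolynomial E γ c m) = m e ^ 2 := by
  rw [coeff_quotTwoForestPolynomial, Finset.sum_eq_zero fun T' _ => if_neg (sdiff_ne_sdiff_add_single he heB), zero_add]
  have hmem : B ∈ γᶜ.powerset.filter
      (fun B : Finset (Fin N) => ((cycleMatroid E) ／ (↑γ : Set (Fin N))).IsBase (↑B : Set (Fin N))) :=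
    Finset.mem_filter.2 ⟨Finset.mem_powerset.2 hBγ, hB⟩
  rw [Finset.sum_eq_single_of_mem B hmem fun B' hB' hB'B => ?_]
  · rw [Finset.sum_eq_single_of_mem e he fun e' _ he' => if_neg fun h => he' ?_]
    · exact if_pos rfl
    · exact (sdiff_add_single_inj hBγ hBγ he heB h).2
  · refine Finset.sum_eq_zero fun e' _ => if_neg fun h => hB'B ?_
    exact (sdiff_add_single_inj hBγ (Finset.mem_powerset.1 (Finset.mem_filter.1 hB').1) he heB h).1

/-- The quotient's mass part of a coefficient is non-negative. [cite: BorinskyMunchTellander2023, §2.1 eq. (polyUF)] -/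
theorem sum_quotCutEdges_sq_nonneg (γ : Finset (Fin N)) (m : Fin N → ℝ) (T' : Finset (Fin N)) :
    0 ≤ ∑ e ∈ quotCutEdges E γ T', m e ^ 2 :=
  Finset.sum_nonneg fun _ _ => sq_nonneg _

open scoped Classical in
/-- **In a connected graph every spanning 2-forest of `G/γ` has a non-empty cut**: the independent set `T'` of `M(G)/γ` one short of
a base extends to a base `T' + e` (Mathlib `Matroid.Indep.exists_isBase_superset`; bases of `M(G)/γ` have `|V_G| − 1 − rk γ` elements,
`contract_isBase_iff_indep_card`). [cite: Oxley2011, §3.1 Prop. 3.1.7 and eq. (3.1.6) (bases and rank of a contraction), §1.2 (bases = maximal independent sets)] -/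
theorem quotCutEdges_nonempty (hconn : IsConnectedEdgeList E) {γ T' : Finset (Fin N)}
    (hT' : ((cycleMatroid E) ／ (↑γ : Set (Fin N))).Indep (↑T' : Set (Fin N)) ∧ T'.card + 2 + edgeRank E γ = V + 1) :
    (quotCutEdges E γ T').Nonempty := by
  obtain ⟨B, hB, hTB⟩ := hT'.1.exists_isBase_superset
  have hBfin : B.Finite := B.toFinite
  have hBT : ((hBfin.toFinset : Finset (Fin N)) : Set (Fin N)) = B := hBfin.coe_toFinset
  have hBγ : hBfin.toFinset ⊆ γᶜ := by
    intro e he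
    have heE : e ∈ ((cycleMatroid E) ／ (↑γ : Set (Fin N))).E := hB.subset_ground (by rw [← hBT]; exact Finset.mem_coe.2 he)
    rw [contract_ground, cycleMatroid_ground] at heE
    exact Finset.mem_compl.2 fun h => heE.2 (Finset.mem_coe.2 h)
  have hBbase : ((cycleMatroid E) ／ (↑γ : Set (Fin N))).IsBase (↑hBfin.toFinset : Set (Fin N)) := by rw [hBT]; exact hB
  have hcardB := ((contract_isBase_iff_indep_card E hconn hBγ).1 hBbase).2
  have hTB' : T' ⊆ hBfin.toFinset := fun e he => by
    rw [← Finset.mem_coe, hBT]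
    exact hTB (Finset.mem_coe.2 he)
  have hcard : (hBfin.toFinset \ T').card = 1 := by
    rw [Finset.card_sdiff_of_subset hTB']
    have := hT'.2
    omega
  obtain ⟨e, he⟩ := Finset.card_eq_one.1 hcard
  have heBT : e ∈ hBfin.toFinset \ T' := by
    rw [he]
    exact Finset.mem_singleton_self e
  rw [Finset.mem_sdiff] at heBT
  refine ⟨e, Finset.mem_filter.2 ⟨hBγ heBT.1, heBT.2, ?_⟩⟩
  have hins : insert e T' = hBfin.toFinset := by
    rw [Finset.insert_eq, ← he, Finset.sdiff_union_of_subset hTB']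
  rw [hins]
  exact hBbase

open scoped Classical in
/-- **Support comparison for the quotient shape with fixed masses** (as for `G` itself: the coefficients away from the 2-forest
exponents do not see `c`). [cite: BorinskyMunchTellander2023, Theorem 3.6 (proof, main.tex l.772–778)] -/
theorem support_quotTwoForestPolynomial_subset {γ : Finset (Fin N)} {c c' : Finset (Fin N) → ℝ} {m : Fin N → ℝ}
    (h : ∀ T', T' ⊆ γᶜ →
      ((cycleMatroid E) ／ (↑γ : Set (Fin N))).Indep (↑T' : Set (Fin N)) ∧ T'.card + 2 + edgeRank E γ = V + 1 →
      c' T' + ∑ e ∈ quotCutEdges E γ T', m e ^ 2 = 0 → c T' + ∑ e ∈ quotCutEdges E γ T', m e ^ 2 = 0) :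
    (quotTwoForestPolynomial E γ c m).support ⊆ (quotTwoForestPolynomial E γ c' m).support := by
  intro d hd
  rw [mem_support_iff] at hd ⊢
  intro h0
  apply hd
  by_cases hex : ∃ T', T' ⊆ γᶜ ∧
      (((cycleMatroid E) ／ (↑γ : Set (Fin N))).Indep (↑T' : Set (Fin N)) ∧ T'.card + 2 + edgeRank E γ = V + 1) ∧
      ∑ e' ∈ γᶜ \ T', Finsupp.single e' 1 = d
  · obtain ⟨T', hT'γ, hT', rfl⟩ := hex
    rw [coeff_quotTwoForestPolynomial_quotTwoForest γ c' m hT'γ hT'] at h0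
    rw [coeff_quotTwoForestPolynomial_quotTwoForest γ c m hT'γ hT']
    exact h T' hT'γ hT' h0
  · push Not at hex
    have hz : ∀ c'' : Finset (Fin N) → ℝ, (∑ T' ∈ γᶜ.powerset.filter (fun T' : Finset (Fin N) =>
        ((cycleMatroid E) ／ (↑γ : Set (Fin N))).Indep (↑T' : Set (Fin N)) ∧ T'.card + 2 + edgeRank E γ = V + 1),
        if ∑ e' ∈ γᶜ \ T', Finsupp.single e' 1 = d then c'' T' else 0) = 0 := fun c'' =>
      Finset.sum_eq_zero fun T' hT' => if_neg (hex T' (Finset.mem_powerset.1 (Finset.mem_filter.1 hT').1)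
        (Finset.mem_filter.1 hT').2)
    rw [coeff_quotTwoForestPolynomial, hz c'] at h0
    rw [coeff_quotTwoForestPolynomial, hz c]
    exact h0

/-- Equal supports when the vanishing conditions at every spanning 2-forest of `G/γ` are equivalent.
[cite: BorinskyMunchTellander2023, Theorem 3.6 (proof, main.tex l.772–778)] -/
theorem support_quotTwoForestPolynomial_eq {γ : Finset (Fin N)} {c c' : Finset (Fin N) → ℝ} {m : Fin N → ℝ}
    (h : ∀ T', T' ⊆ γᶜ →
      ((cycleMatroid E) ／ (↑γ : Set (Fin N))).Indep (↑T' : Set (Fin N)) ∧ T'.card + 2 + edgeRank E γ = V + 1 →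
      (c T' + ∑ e ∈ quotCutEdges E γ T', m e ^ 2 = 0 ↔ c' T' + ∑ e ∈ quotCutEdges E γ T', m e ^ 2 = 0)) :
    (quotTwoForestPolynomial E γ c m).support = (quotTwoForestPolynomial E γ c' m).support :=
  Finset.Subset.antisymm (support_quotTwoForestPolynomial_subset fun T' h1 h2 => (h T' h1 h2).2)
    (support_quotTwoForestPolynomial_subset fun T' h1 h2 => (h T' h1 h2).1)

end Support

/-! ## Part 3 — the auxiliary momenta across an ARBITRARY edge set: separated external vertices ⟺ non-zero root-side flow -/

section Separation

variable {E}
variable {P : Matrix (Fin (V + 1)) (Fin (V + 1)) ℝ}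

/-- If the external vertices are not split by the root side of `F` (none there, or all there), the auxiliary flow vanishes
(conservation). [cite: Brown2017, §1.4 ("γ is momentum-spanning if and only if G/γ is equivalent to a graph with no external momenta (by momentum conservation)"); BorinskyMunchTellander2023, §2.2 (main.tex l.330–331)] -/
theorem momentumFlow_auxMomenta_eq_zero_of_not_sep {F : Finset (Fin N)}
    (h : ¬ ((∃ a, IsExternal P a ∧ a ∈ rootSide E F) ∧ ∃ b, IsExternal P b ∧ b ∉ rootSide E F)) :
    momentumFlow E F (auxMomenta P) = 0 := by
  classical
  rw [momentumFlow_eq_sum_rootSide]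
  rw [not_and_or] at h
  rcases h with h | h
  · push Not at h
    exact Finset.sum_eq_zero fun v hv => auxMomenta_of_not_isExternal fun hext => h v hext hv
  · push Not at h
    have hout : ∑ v ∈ (rootSide E F)ᶜ, auxMomenta P v = 0 :=
      Finset.sum_eq_zero fun v hv => auxMomenta_of_not_isExternal fun hext => (Finset.mem_compl.1 hv) (h v hext)
    have := Finset.sum_add_sum_compl (rootSide E F) (auxMomenta P)
    rw [sum_auxMomenta, hout, add_zero] at this
    exact this

/-- If the root side of `F` contains an external vertex and misses another, the auxiliary flow is non-zero (genericity of `p̃`).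
[cite: BorinskyMunchTellander2023, Theorem 3.6 (proof: "the Euclidean regime with generic kinematics"); Brown2017, Lemma 1.12 (proof)] -/
theorem momentumFlow_auxMomenta_ne_zero_of_sep (hP : P.IsSymm) (hcons : ∀ u, ∑ v, P u v = 0) {F : Finset (Fin N)}
    (ha : ∃ a, IsExternal P a ∧ a ∈ rootSide E F) (hb : ∃ b, IsExternal P b ∧ b ∉ rootSide E F) :
    momentumFlow E F (auxMomenta P) ≠ 0 := by
  classical
  obtain ⟨a, ha, haS⟩ := ha
  obtain ⟨b, hb, hbS⟩ := hb
  set I := (rootSide E F).filter (fun v => auxMomenta P v ≠ 0) with hI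
  have hflow : momentumFlow E F (auxMomenta P) = ∑ v ∈ I, auxMomenta P v := by
    rw [momentumFlow_eq_sum_rootSide, hI, Finset.sum_filter_ne_zero]
  rw [hflow]
  refine isGenericMomenta_auxMomenta hP hcons I ⟨a, Finset.mem_filter.2 ⟨haS, auxMomenta_ne_zero hP hcons ha⟩⟩
    (fun v hv => (Finset.mem_filter.1 hv).2) ⟨b, fun h => hbS (Finset.mem_filter.1 h).1, auxMomenta_ne_zero hP hcons hb⟩

/-- Hence `p̃(F) = 0 ⟺` the external vertices are not split by `F`. [cite: Brown2017, §1.4 and Lemma 1.12; BorinskyMunchTellander2023, Theorem 3.6 (proof)] -/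
theorem momentumFlow_auxMomenta_eq_zero_iff (hP : P.IsSymm) (hcons : ∀ u, ∑ v, P u v = 0) (F : Finset (Fin N)) :
    momentumFlow E F (auxMomenta P) = 0 ↔
      ¬ ((∃ a, IsExternal P a ∧ a ∈ rootSide E F) ∧ ∃ b, IsExternal P b ∧ b ∉ rootSide E F) :=
  ⟨fun h0 hsep => momentumFlow_auxMomenta_ne_zero_of_sep hP hcons hsep.1 hsep.2 h0, momentumFlow_auxMomenta_eq_zero_of_not_sep⟩

/-- Not split ⟹ the root side has squared momentum `0`. [cite: BorinskyMunchTellander2023, §2.2 (main.tex l.330–331, l.377–380)] -/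
theorem sqMomentum_rootSide_eq_zero_of_not_sep (hP : P.IsSymm) (hcons : ∀ u, ∑ v, P u v = 0) {F : Finset (Fin N)}
    (h : ¬ ((∃ a, IsExternal P a ∧ a ∈ rootSide E F) ∧ ∃ b, IsExternal P b ∧ b ∉ rootSide E F)) :
    sqMomentum P (rootSide E F) = 0 := by
  rw [not_and_or] at h
  rcases h with h | h
  · push Not at h
    exact sqMomentum_eq_zero_of_forall_not_isExternal hP fun v hv hext => h v hext hv
  · push Not at h
    exact sqMomentum_eq_zero_of_forall_isExternal_mem hP hcons h

open scoped Classical in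
/-- Split ⟹ under generic kinematics the root side's squared momentum differs from every non-empty sum of squared masses
(eq. (generic kinematics) at `V' = V^ext ∩ root side`). [cite: BorinskyMunchTellander2023, §2.2 eq. (generic kinematics) (main.tex l.382–385)] -/
theorem sqMomentum_rootSide_ne_of_sep (hP : P.IsSymm) {m : Fin N → ℝ} (hgen : IsGeneric P m) {F : Finset (Fin N)}
    (ha : ∃ a, IsExternal P a ∧ a ∈ rootSide E F) (hb : ∃ b, IsExternal P b ∧ b ∉ rootSide E F)
    {E' : Finset (Fin N)} (hE' : E'.Nonempty) : sqMomentum P (rootSide E F) ≠ ∑ e ∈ E', m e ^ 2 := by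
  obtain ⟨a, ha, haS⟩ := ha
  obtain ⟨b, hb, hbS⟩ := hb
  rw [sqMomentum_eq_filter_isExternal hP]
  exact hgen _ ⟨a, Finset.mem_filter.2 ⟨haS, ha⟩⟩ (fun v hv => (Finset.mem_filter.1 hv).2)
    ⟨b, hb, fun h => hbS (Finset.mem_filter.1 h).1⟩ E' hE'

end Separation

/-! ## Part 4 — `supp ℱ_{G/γ}(𝒫) ⊆ supp Ξ_{G/γ}(p̃)`, equality under generic kinematics; BMT23's m.m. ⟺ the combinatorial m.m.; THEOREM 3.6 with the literal `z_ℱ` -/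

/-- The exponent vectors of `p` read in `ℝⁿ` — the companions' local notation (no new definition). -/
local notation3 (prettyPrint := false) "pts⟦" p "⟧" =>
  ((fun d : (_ →₀ ℕ) => fun k => ((d k : ℕ) : ℝ)) '' {d | d ∈ MvPolynomial.support p})

/-- The Newton polytope `NP_p = conv(supp p)` — the companions' local notation (no new definition). -/
local notation3 (prettyPrint := false) "NP⟦" p "⟧" => convexHull ℝ pts⟦p⟧

section MassMomentum

variable {E}
variable {P : Matrix (Fin (V + 1)) (Fin (V + 1)) ℝ}

/-- **`ℱ_{G/γ}` can only lose monomials**: `supp ℱ_{G/γ}(𝒫) ⊆ supp Ξ_{G/γ}(p̃)` for every symmetric conserved `𝒫` (at a spanning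
2-forest `T'` of `G/γ`: `‖p̃(γ∪T')‖² + Σ_{cut} m_e² = 0` forces the externals unsplit, hence `−p(γ∪T')² + Σ_{cut} m_e² = 0`).
[cite: BorinskyMunchTellander2023, before Theorem 3.9 (main.tex l.855–856) with §3.3 (l.715–717)] -/
theorem support_gramSecondSymanzikQuot_subset (hP : P.IsSymm) (hcons : ∀ u, ∑ v, P u v = 0) (γ : Finset (Fin N))
    (m : Fin N → ℝ) :
    (gramSecondSymanzikQuot E γ P m).support ⊆ (secondSymanzikQuot E γ (auxMomenta P) m).support := by
  rw [secondSymanzikQuot_eq_quotTwoForestPolynomial]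
  refine support_quotTwoForestPolynomial_subset fun T' _ _ h0 => ?_
  obtain ⟨hfl, hM⟩ := (add_eq_zero_iff_of_nonneg (sq_nonneg _) (sum_quotCutEdges_sq_nonneg γ m T')).1 h0
  rw [sq_eq_zero_iff, norm_eq_zero, momentumFlow_auxMomenta_eq_zero_iff hP hcons] at hfl
  rw [sqMomentum_rootSide_eq_zero_of_not_sep hP hcons hfl, hM, neg_zero, add_zero]

/-- **Under generic kinematics `ℱ_{G/γ}(𝒫)` and `Ξ_{G/γ}(p̃)` have the same monomials** (no cancellation between the quotient's
momentum and mass parts: (generic kinematics) at `V' = V^ext ∩ (root side of γ ∪ T')`, `E' = cut_γ(T') ≠ ∅`).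
[cite: BorinskyMunchTellander2023, Theorem 3.6 (proof, main.tex l.772–778), §2.2 (l.391–392), §3.3 (l.715–717)] -/
theorem support_gramSecondSymanzikQuot_eq (hconn : IsConnectedEdgeList E) (hP : P.IsSymm) (hcons : ∀ u, ∑ v, P u v = 0)
    {m : Fin N → ℝ} (hgen : IsGeneric P m) (γ : Finset (Fin N)) :
    (gramSecondSymanzikQuot E γ P m).support = (secondSymanzikQuot E γ (auxMomenta P) m).support := by
  rw [secondSymanzikQuot_eq_quotTwoForestPolynomial]
  refine support_quotTwoForestPolynomial_eq fun T' hT'γ hT' => ⟨fun h0 => ?_, fun h0 => ?_⟩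
  · have hns : ¬ ((∃ a, IsExternal P a ∧ a ∈ rootSide E (γ ∪ T')) ∧ ∃ b, IsExternal P b ∧ b ∉ rootSide E (γ ∪ T')) := by
      intro hsep
      have hne := sqMomentum_rootSide_ne_of_sep hP hgen hsep.1 hsep.2 (quotCutEdges_nonempty hconn hT')
      exact hne (by linarith)
    have hsq := sqMomentum_rootSide_eq_zero_of_not_sep hP hcons hns
    rw [hsq, neg_zero, zero_add] at h0
    rw [momentumFlow_auxMomenta_eq_zero_of_not_sep hns, norm_zero, h0]
    ring
  · obtain ⟨hfl, hM⟩ := (add_eq_zero_iff_of_nonneg (sq_nonneg _) (sum_quotCutEdges_sq_nonneg γ m T')).1 h0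
    rw [sq_eq_zero_iff, norm_eq_zero, momentumFlow_auxMomenta_eq_zero_iff hP hcons] at hfl
    rw [sqMomentum_rootSide_eq_zero_of_not_sep hP hcons hfl, hM, neg_zero, add_zero]

/-- **Combinatorially m.m. ⟹ `ℱ_{G/γ}(𝒫) = 0`**, for every symmetric conserved `𝒫` (no genericity): the companion's
`secondSymanzikQuot_eq_zero_of_isMassMomentumSpanning` for `p̃` and the support inclusion. [cite: BorinskyMunchTellander2023, §3.3 (main.tex l.715–717); Brown2017, §1.4 and eq. (2.5); Borinsky2020, §7.1 (tropical.tex l.1195)] -/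
theorem gramSecondSymanzikQuot_eq_zero_of_isMassMomentumSpanningGram (hP : P.IsSymm) (hcons : ∀ u, ∑ v, P u v = 0)
    {m : Fin N → ℝ} {γ : Finset (Fin N)} (hmm : IsMassMomentumSpanningGram E P m γ) :
    gramSecondSymanzikQuot E γ P m = 0 := by
  have haux : secondSymanzikQuot E γ (auxMomenta P) m = 0 :=
    secondSymanzikQuot_eq_zero_of_isMassMomentumSpanning E (sum_auxMomenta P)
      ((isMassMomentumSpanning_auxMomenta_iff hP hcons m γ).2 hmm)
  rw [← support_eq_empty] at haux ⊢
  exact Finset.subset_empty.1 (haux ▸ support_gramSecondSymanzikQuot_subset hP hcons γ m)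

/-- **BMT23's definition of mass-momentum spanning ⟺ the combinatorial one, for `𝒫`-kinematics under (generic kinematics)** on a
connected graph: "ℱ_{G/γ} = 0" iff `γ` contains every massive edge and joins all external vertices ("We use the following
slightly generalized version of Brown's definition …"; Brown eq. (2.5) "For generic kinematics … γ is m.m. ⟺ Ξ_{G/γ}(q,m) = 0";
Borinsky: "Mass-momentum-spanning graphs can also be defined combinatorially …"). [cite: BorinskyMunchTellander2023, §3.3 (main.tex l.715–717); Brown2017, eq. (2.5); Borinsky2020, §7.1 (tropical.tex l.1195)] -/
theorem isMassMomentumSpanningGram_iff_gramSecondSymanzikQuot_eq_zero (hconn : IsConnectedEdgeList E) (hP : P.IsSymm)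
    (hcons : ∀ u, ∑ v, P u v = 0) {m : Fin N → ℝ} (hgen : IsGeneric P m) (γ : Finset (Fin N)) :
    IsMassMomentumSpanningGram E P m γ ↔ gramSecondSymanzikQuot E γ P m = 0 := by
  rw [← isMassMomentumSpanning_auxMomenta_iff hP hcons m γ,
    isMassMomentumSpanning_iff_secondSymanzikQuot_eq_zero E hconn (sum_auxMomenta P) (isGenericMomenta_auxMomenta hP hcons) m γ,
    ← support_eq_empty, ← support_eq_empty, support_gramSecondSymanzikQuot_eq hconn hP hcons hgen]

open scoped Classical in
/-- Hence under generic kinematics the literal `z_ℱ` is the combinatorial one. [cite: BorinskyMunchTellander2023, Theorem 3.5 (main.tex l.740–746) with §3.3] -/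
theorem zBMT_eq_zGram (hconn : IsConnectedEdgeList E) (hP : P.IsSymm) (hcons : ∀ u, ∑ v, P u v = 0) {m : Fin N → ℝ}
    (hgen : IsGeneric P m) : zBMT E P m = zGram E P m := by
  funext γ
  rw [zBMT, zGram]
  congr 1
  exact if_congr (isMassMomentumSpanningGram_iff_gramSecondSymanzikQuot_eq_zero hconn hP hcons hgen γ).symm rfl rfl

/-- `zGram ≤ z_ℱ` pointwise, for every symmetric conserved `𝒫` (BMT23's predicate holds for at least the combinatorially m.m. `γ`).
[cite: BorinskyMunchTellander2023, Theorem 3.5 / §3.3 (main.tex l.715–717, l.740–746)] -/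
theorem zGram_le_zBMT (hP : P.IsSymm) (hcons : ∀ u, ∑ v, P u v = 0) (m : Fin N → ℝ) (γ : Finset (Fin N)) :
    zGram E P m γ ≤ zBMT E P m γ := by
  classical
  rw [zBMT, zGram]
  by_cases hmm : IsMassMomentumSpanningGram E P m γ
  · rw [if_pos hmm, if_pos (gramSecondSymanzikQuot_eq_zero_of_isMassMomentumSpanningGram hP hcons hmm)]
  · rw [if_neg hmm]
    split_ifs <;> simp

/-- **THEOREM 3.6 with the LITERAL `z_ℱ`** ("Theorem 3.5 holds in all regimes if the kinematics are generic", Theorem 3.5's `z_ℱ(γ)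
= L_γ + 1` iff "ℱ_{G/γ} = 0"): for `ℱ` from any symmetric `𝒫` with vanishing row sums and real masses on a connected edge list, under
(generic kinematics), `N[ℱ] = P[z_ℱ]`. [cite: BorinskyMunchTellander2023, Theorem 3.6 (main.tex l.766–779) with Theorem 3.5 (l.740–748) and §3.3 (l.715–717)] -/
theorem newtonPolytope_gramSecondSymanzik_eq_gpPolytope_zBMT (hconn : IsConnectedEdgeList E) (hP : P.IsSymm)
    (hcons : ∀ u, ∑ v, P u v = 0) {m : Fin N → ℝ} (hgen : IsGeneric P m) :
    NP⟦gramSecondSymanzik E P m⟧ = gpPolytope (zBMT E P m) := by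
  rw [zBMT_eq_zGram hconn hP hcons hgen]
  exact newtonPolytope_gramSecondSymanzik_eq_gpPolytope hconn hP hcons hgen

/-- "Consequently, this function z_ℱ : 2^E → ℝ is supermodular" — for the literal `z_ℱ` under generic kinematics (for exceptional
kinematics BMT23 exhibit non-supermodular `z_ℱ`, §3.3 after Conjecture 3.7 — not typed). [cite: BorinskyMunchTellander2023, Theorem 3.5/3.6 (main.tex l.747, l.768–769)] -/
theorem supermodular_zBMT (hconn : IsConnectedEdgeList E) (hP : P.IsSymm) (hcons : ∀ u, ∑ v, P u v = 0) {m : Fin N → ℝ}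
    (hgen : IsGeneric P m) : Supermodular (zBMT E P m) := by
  rw [zBMT_eq_zGram hconn hP hcons hgen]
  exact supermodular_zGram hP hcons m

end MassMomentum

/-! ## Part 5 — THEOREM 3.9 with the LITERAL `z_ℱ`: `N[ℱ] ⊂ P[z_ℱ]` for EVERY symmetric conserved `𝒫` (exceptional kinematics included) -/

section Bound

variable {E}
variable {P : Matrix (Fin (V + 1)) (Fin (V + 1)) ℝ}

open scoped Classical in
/-- `ℱ_{G/G} = 0`: the quotient by the whole connected graph is a point (no spanning 2-forest of `G/G`, no edge left).
[cite: Brown2017, §1.4 ("γ is momentum-spanning if and only if G/γ is equivalent to a graph with no external momenta"); BorinskyMunchTellander2023, §3.3] -/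
theorem gramSecondSymanzikQuot_univ (hconn : IsConnectedEdgeList E) (P : Matrix (Fin (V + 1)) (Fin (V + 1)) ℝ) (m : Fin N → ℝ) :
    gramSecondSymanzikQuot E univ P m = 0 := by
  unfold gramSecondSymanzikQuot quotTwoForestPolynomial
  have hrk : edgeRank E univ = V := (isConnectedEdgeList_iff_edgeRank_univ E).1 hconn
  rw [Finset.sum_eq_zero, zero_add, Finset.compl_univ, Finset.sum_empty, mul_zero]
  intro T' hT'
  exfalso
  have h1 := Finset.mem_filter.1 hT'
  rw [Finset.compl_univ, Finset.powerset_empty, Finset.mem_singleton] at h1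
  obtain ⟨rfl, -, h2⟩ := h1
  rw [Finset.card_empty, hrk] at h2
  omega

/-- `z_ℱ(E) = L + 1`. [cite: BorinskyMunchTellander2023, Theorem 3.5 (main.tex l.740–746)] -/
theorem zBMT_univ (hconn : IsConnectedEdgeList E) (P : Matrix (Fin (V + 1)) (Fin (V + 1)) ℝ) (m : Fin N → ℝ) :
    zBMT E P m univ = loopNumber E univ + 1 := by
  classical
  rw [zBMT, if_pos (gramSecondSymanzikQuot_univ hconn P m)]

/-- `zGram(E) = L + 1` (the whole connected graph is combinatorially m.m.). [cite: BorinskyMunchTellander2023, Theorem 3.5 (main.tex l.740–746)] -/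
theorem zGram_univ (hconn : IsConnectedEdgeList E) (hP : P.IsSymm) (hcons : ∀ u, ∑ v, P u v = 0) (m : Fin N → ℝ) :
    zGram E P m univ = loopNumber E univ + 1 := by
  classical
  rw [zGram, if_pos ((isMassMomentumSpanning_auxMomenta_iff hP hcons m univ).1
    (isMassMomentumSpanning_univ hconn (auxMomenta P) m))]

/-- A spanning 2-forest `F` of `G` meeting `γ` maximally (`|F ∩ γ| = rk γ`) has `F ∩ γ` a maximal forest (basis) of `γ`.
[cite: Schultka2018, §4 after Corollary 4.12 (toricfeynman.tex l.2318–2323); Brown2017, Lemma 2.1] -/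
theorem isBasis_inter_of_card_eq {F γ : Finset (Fin N)} (hFind : edgeRank E F = F.card) (hcard : (F ∩ γ).card = edgeRank E γ) :
    (cycleMatroid E).IsBasis (↑(F ∩ γ) : Set (Fin N)) (↑γ : Set (Fin N)) :=
  (isBasis_cycleMatroid_iff E (F ∩ γ) γ).2
    ⟨Finset.inter_subset_right, edgeRank_eq_card_of_subset hFind Finset.inter_subset_left, hcard⟩

/-- For such an `F` the graphs `F` and `γ ∪ F` have the same components (same rank), hence the same root side — "the kinematics of
G/γ are inherited from G": the quotient 2-forest `F ∖ γ` of `G/γ` carries the squared momentum of `F`.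
[cite: Schultka2018, §4 before Proposition 4.11 (toricfeynman.tex l.2209–2212); Brown2017, Lemma 2.1] -/
theorem rootSide_eq_rootSide_union_sdiff {F γ : Finset (Fin N)} (hFind : edgeRank E F = F.card)
    (hcard : (F ∩ γ).card = edgeRank E γ) : rootSide E F = rootSide E (γ ∪ (F \ γ)) := by
  classical
  have hB := isBasis_inter_of_card_eq hFind hcard
  have hrk := edgeRank_union_eq_of_isBasis E hB (F \ γ)
  rw [Finset.union_comm (F ∩ γ), Finset.sdiff_union_inter] at hrk
  have hsub : F ⊆ γ ∪ (F \ γ) := fun x hx => by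
    by_cases hxγ : x ∈ γ
    · exact Finset.mem_union_left _ hxγ
    · exact Finset.mem_union_right _ (Finset.mem_sdiff.2 ⟨hx, hxγ⟩)
  unfold rootSide
  exact Finset.filter_congr fun v _ => reachable_iff_reachable_of_subset_of_edgeRank_eq E hsub hrk 0 v

open scoped Classical in
/-- For such an `F`, `F ∖ γ` is a spanning 2-forest of `G/γ` (Lemma 2.1 for 2-forests). [cite: Brown2017, Lemma 2.1; Oxley2011, §3.1 Prop. 3.1.7] -/
theorem sdiff_mem_quotTwoForests {F γ : Finset (Fin N)} (hF : IsSpanningTwoForest E F)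
    (hcard : (F ∩ γ).card = edgeRank E γ) :
    F \ γ ⊆ γᶜ ∧ ((cycleMatroid E) ／ (↑γ : Set (Fin N))).Indep (↑(F \ γ) : Set (Fin N)) ∧
      (F \ γ).card + 2 + edgeRank E γ = V + 1 := by
  have hB := isBasis_inter_of_card_eq hF.2 hcard
  refine ⟨fun x hx => Finset.mem_compl.2 (Finset.mem_sdiff.1 hx).2, ?_, ?_⟩
  · rw [hB.contract_indep_iff, ← Finset.coe_union, Finset.sdiff_union_inter, indep_cycleMatroid_iff_edgeRank,
      Finset.disjoint_coe]
    exact ⟨hF.2, Finset.disjoint_sdiff⟩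
  · have h1 := Finset.card_sdiff_add_card_inter F γ
    have h2 := hF.1
    omega

open scoped Classical in
/-- For such an `F`, the cut of `F` in `G` is the cut of `F ∖ γ` in `G/γ` (an edge of `γ` never completes `F` to a spanning tree:
`F ∩ γ` is already a maximal forest of `γ`). [cite: Brown2017, Lemma 2.1 and Prop. 2.2 (proof); Schultka2018, Proposition 4.11 proof sketch (toricfeynman.tex l.2283–2296)] -/
theorem cutEdges_eq_quotCutEdges (hconn : IsConnectedEdgeList E) {F γ : Finset (Fin N)} (hF : IsSpanningTwoForest E F)
    (hcard : (F ∩ γ).card = edgeRank E γ) : cutEdges E F = quotCutEdges E γ (F \ γ) := by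
  have hB := isBasis_inter_of_card_eq hF.2 hcard
  -- the key dictionary: for `e ∉ γ`, `F + e` is a spanning tree of `G` iff `(F ∖ γ) + e` is a base of `M(G)/γ`
  have hkey : ∀ e, e ∉ γ → (IsSpanningTree E (insert e F) ↔
      ((cycleMatroid E) ／ (↑γ : Set (Fin N))).IsBase (↑(insert e (F \ γ)) : Set (Fin N))) := fun e heγ => by
    have hdisj : Disjoint (insert e (F \ γ)) γ :=
      Finset.disjoint_insert_left.2 ⟨heγ, Finset.sdiff_disjoint⟩
    rw [contract_isBase_iff_of_isBasis E hB hdisj, Finset.insert_union, Finset.sdiff_union_inter,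
      isBase_cycleMatroid_iff_isSpanningTree E hconn]
  ext e
  rw [cutEdges, Finset.mem_filter, quotCutEdges, Finset.mem_filter, Finset.mem_compl, Finset.mem_sdiff]
  constructor
  · rintro ⟨-, heF, hT⟩
    have heγ : e ∉ γ := by
      intro heγ
      -- `insert e (F ∩ γ) ⊆ γ` would be independent of size `rk γ + 1`
      have hind : edgeRank E (insert e (F ∩ γ)) = (insert e (F ∩ γ)).card :=
        edgeRank_eq_card_of_subset (hT.2.trans hT.1.symm)
          (Finset.insert_subset_insert e Finset.inter_subset_left)
      have hle : edgeRank E (insert e (F ∩ γ)) ≤ edgeRank E γ :=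
        edgeRank_mono (Finset.insert_subset heγ Finset.inter_subset_right)
      rw [hind, Finset.card_insert_of_notMem (fun h => heF (Finset.mem_inter.1 h).1), hcard] at hle
      omega
    exact ⟨heγ, fun h => heF h.1, (hkey e heγ).1 hT⟩
  · rintro ⟨heγ, heF, hbase⟩
    exact ⟨Finset.mem_univ _, fun h => heF ⟨h, heγ⟩, (hkey e heγ).2 hbase⟩

/-- **The leading coefficients of `ℱ_G` are coefficients of `ℱ_{G/γ}`**: for a spanning 2-forest `F` of `G` with `|F ∩ γ| = rk γ`
(its monomial has exactly `L_γ` variables of `γ`), `[x^{𝟙_{E∖F}}] ℱ_G(𝒫) = [x^{𝟙_{(E∖γ)∖(F∖γ)}}] ℱ_{G/γ}(𝒫)` — the coefficient-level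
content of the UV factorisation `ℱ_G = 𝒰_γ ℱ_{G/γ} + R^UV` (Brown Thm 2.7) for `𝒫`-kinematics.
[cite: Brown2017, Thm 2.7 eq. (XiUVfact) and Lemma 2.1; BorinskyMunchTellander2023, §2.1 eq. (polyUF), §3.3] -/
theorem coeff_gramSecondSymanzik_eq_coeff_quot (hconn : IsConnectedEdgeList E) (P : Matrix (Fin (V + 1)) (Fin (V + 1)) ℝ)
    (m : Fin N → ℝ) {F γ : Finset (Fin N)} (hF : IsSpanningTwoForest E F) (hcard : (F ∩ γ).card = edgeRank E γ) :
    coeff (∑ e' ∈ Fᶜ, Finsupp.single e' 1) (gramSecondSymanzik E P m) =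
      coeff (∑ e' ∈ γᶜ \ (F \ γ), Finsupp.single e' 1) (gramSecondSymanzikQuot E γ P m) := by
  obtain ⟨h1, h2⟩ := sdiff_mem_quotTwoForests hF hcard
  rw [gramSecondSymanzik, coeff_twoForestPolynomial_twoForest _ m hF, gramSecondSymanzikQuot,
    coeff_quotTwoForestPolynomial_quotTwoForest γ _ m h1 h2, rootSide_eq_rootSide_union_sdiff hF.2 hcard,
    cutEdges_eq_quotCutEdges hconn hF hcard]

/-- The square-free exponent of the mass monomial `(T, e)` with `e ∈ T` is that of the 2-forest `T − e`. Plumbing. [folklore] -/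
private theorem sum_single_compl_add_single_of_mem {T : Finset (Fin N)} {e : Fin N} (he : e ∈ T) :
    ∑ e' ∈ Tᶜ, Finsupp.single e' (1 : ℕ) + Finsupp.single e 1 = ∑ e' ∈ (T.erase e)ᶜ, Finsupp.single e' 1 := by
  classical
  rw [Finset.compl_erase, Finset.sum_insert (fun h => (Finset.mem_compl.1 h) he), add_comm]

/-- `deg_γ x^{𝟙_{E∖F}} = |γ ∖ F|`. Plumbing. [folklore] -/
private theorem gammaDeg_compl (F γ : Finset (Fin N)) :
    ∑ e ∈ γ, (∑ e' ∈ Fᶜ, Finsupp.single e' (1 : ℕ) : Fin N →₀ ℕ) e = (γ \ F).card := by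
  rw [gammaDeg_sum_single, ← Finset.sdiff_eq_inter_compl]

/-- `deg_γ x^{𝟙_{E∖T} + 𝟙_e} = |γ ∖ T| + [e ∈ γ]`. Plumbing. [folklore] -/
private theorem gammaDeg_compl_add_single (T γ : Finset (Fin N)) (e : Fin N) :
    ∑ x ∈ γ, (∑ e' ∈ Tᶜ, Finsupp.single e' (1 : ℕ) + Finsupp.single e 1 : Fin N →₀ ℕ) x =
      (γ \ T).card + if e ∈ γ then 1 else 0 := by
  classical
  simp only [Finsupp.add_apply, Finset.sum_add_distrib]
  rw [gammaDeg_compl]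
  congr 1
  simp only [Finsupp.single_apply]
  rw [Finset.sum_ite_eq]

/-- A forest meets `γ` in at most `rk γ` edges. [cite: Oxley2011, §1.3 (rank = size of a maximal independent subset)] -/
theorem card_inter_le_edgeRank {F : Finset (Fin N)} (hFind : edgeRank E F = F.card) (γ : Finset (Fin N)) :
    (F ∩ γ).card ≤ edgeRank E γ := by
  rw [← edgeRank_eq_card_of_subset hFind Finset.inter_subset_left]
  exact edgeRank_mono Finset.inter_subset_right

open scoped Classical in
/-- Case of a 2-forest exponent: if `ℱ_{G/γ}(𝒫) = 0` and `x^{𝟙_{E∖F}}` is a monomial of `ℱ_G(𝒫)`, then it has at least `L_γ + 1`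
variables of `γ` (the only candidates with `L_γ` of them are the `F` with `|F ∩ γ| = rk γ`, whose coefficients are those of
`ℱ_{G/γ}`). [cite: Brown2017, Thm 2.7 ("R^{Ξ,UV}_{γ,G}(q,m) has degree > h_γ in the α_e, e ∈ E_γ"); BorinskyMunchTellander2023, Theorem 3.9 (main.tex l.855–859)] -/
theorem loopNumber_add_one_le_gammaDeg_twoForest (hconn : IsConnectedEdgeList E) {m : Fin N → ℝ} {γ F : Finset (Fin N)}
    (h0 : gramSecondSymanzikQuot E γ P m = 0) (hF : IsSpanningTwoForest E F)
    (hd : (∑ e' ∈ Fᶜ, Finsupp.single e' (1 : ℕ)) ∈ (gramSecondSymanzik E P m).support) :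
    loopNumber E γ + 1 ≤ ∑ e ∈ γ, (∑ e' ∈ Fᶜ, Finsupp.single e' (1 : ℕ) : Fin N →₀ ℕ) e := by
  rw [gammaDeg_compl, loopNumber]
  have hle := card_inter_le_edgeRank hF.2 γ
  have hsum := Finset.card_sdiff_add_card_inter γ F
  have hrk := edgeRank_le_card E γ
  rw [Finset.inter_comm] at hsum
  by_cases heq : (F ∩ γ).card = edgeRank E γ
  · exfalso
    rw [mem_support_iff, coeff_gramSecondSymanzik_eq_coeff_quot hconn P m hF heq, h0, coeff_zero] at hd
    exact hd rfl
  · omega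

open scoped Classical in
/-- **`ℱ_{G/γ} = 0 ⟹` every monomial of `ℱ_G` has at least `L_γ + 1` variables of `γ`**, for EVERY symmetric conserved `𝒫`
— the content of "ℱ can only lose monomials if we make the kinematics less generic" behind Theorem 3.9: the monomials of `ℱ_G(𝒫)`
are among those of the Euclidean generic `Ξ_G(p̃)` (2-forests, and (spanning tree, massive edge) pairs), and those with exactly `L_γ`
variables of `γ` carry coefficients of `ℱ_{G/γ}(𝒫)`. [cite: BorinskyMunchTellander2023, Theorem 3.9 (main.tex l.855–859) with §3.3 (l.715–717); Brown2017, Thm 2.7 eq. (XiUVfact)] -/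
theorem loopNumber_add_one_le_gammaDeg (hconn : IsConnectedEdgeList E) (hP : P.IsSymm) (hcons : ∀ u, ∑ v, P u v = 0)
    {m : Fin N → ℝ} {γ : Finset (Fin N)} (h0 : gramSecondSymanzikQuot E γ P m = 0) {d : Fin N →₀ ℕ}
    (hd : d ∈ (gramSecondSymanzik E P m).support) : loopNumber E γ + 1 ≤ ∑ e ∈ γ, d e := by
  have hd' := support_gramSecondSymanzik_subset hP hcons m hd
  rcases exists_of_mem_support_secondSymanzikPolynomial hd' with ⟨F, hF, -, rfl⟩ | ⟨T, e, hT, hme, rfl⟩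
  · exact loopNumber_add_one_le_gammaDeg_twoForest hconn h0 hF hd
  · by_cases heT : e ∈ T
    · rw [sum_single_compl_add_single_of_mem heT] at hd ⊢
      exact loopNumber_add_one_le_gammaDeg_twoForest hconn h0 (hT.isSpanningTwoForest_erase heT) hd
    · rw [gammaDeg_compl_add_single, loopNumber]
      have hTind : edgeRank E T = T.card := hT.2.trans hT.1.symm
      have hle := card_inter_le_edgeRank hTind γ
      have hsum := Finset.card_sdiff_add_card_inter γ T
      have hrk := edgeRank_le_card E γ
      rw [Finset.inter_comm] at hsum
      by_cases heγ : e ∈ γ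
      · rw [if_pos heγ]
        omega
      · rw [if_neg heγ, add_zero]
        by_cases heq : (T ∩ γ).card = edgeRank E γ
        · -- `T ∖ γ` is a spanning tree of `G/γ` avoiding the massive edge `e ∉ γ`: `ℱ_{G/γ}` has the monomial `x_e · x^{𝟙_{(E∖γ)∖(T∖γ)}}`
          exfalso
          have hB := isBasis_inter_of_card_eq hTind heq
          have hdisj : Disjoint (T \ γ) γ := Finset.sdiff_disjoint
          have hbase : ((cycleMatroid E) ／ (↑γ : Set (Fin N))).IsBase (↑(T \ γ) : Set (Fin N)) := by
            rw [contract_isBase_iff_of_isBasis E hB hdisj, Finset.sdiff_union_inter,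
              isBase_cycleMatroid_iff_isSpanningTree E hconn]
            exact hT
          have hc := coeff_quotTwoForestPolynomial_base_add_single γ
            (fun T' => -sqMomentum P (rootSide E (γ ∪ T'))) m (fun x hx => Finset.mem_compl.2 (Finset.mem_sdiff.1 hx).2)
            hbase (Finset.mem_compl.2 heγ) (fun h => heT (Finset.mem_sdiff.1 h).1)
          have h0' := h0
          rw [gramSecondSymanzikQuot] at h0'
          rw [h0', coeff_zero] at hc
          exact hme (by have := sq_eq_zero_iff.1 hc.symm; exact this)
        · omega

/-- **Every exponent of `ℱ_G(𝒫)` lies in `P[z_ℱ]` with the literal `z_ℱ`**, for every symmetric conserved `𝒫` on a connected edge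
list. [cite: BorinskyMunchTellander2023, Theorem 3.9 (main.tex l.855–859)] -/
theorem natCast_mem_gpPolytope_zBMT (hconn : IsConnectedEdgeList E) (hP : P.IsSymm) (hcons : ∀ u, ∑ v, P u v = 0)
    {m : Fin N → ℝ} {d : Fin N →₀ ℕ} (hd : d ∈ (gramSecondSymanzik E P m).support) :
    (fun k => ((d k : ℕ) : ℝ)) ∈ gpPolytope (zBMT E P m) := by
  classical
  have h1 := natCast_mem_gpPolytope_of_mem_support hconn (sum_auxMomenta P) (support_gramSecondSymanzik_subset hP hcons m hd)
  rw [zSecondSymanzik_auxMomenta hP hcons m, mem_gpPolytope] at h1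
  rw [mem_gpPolytope, zBMT_univ hconn, ← zGram_univ hconn hP hcons m]
  refine ⟨h1.1, fun I => ?_⟩
  by_cases hI : gramSecondSymanzikQuot E I P m = 0
  · rw [zBMT, if_pos hI]
    have h2 := loopNumber_add_one_le_gammaDeg hconn hP hcons hI hd
    have h3 : (∑ i ∈ I, ((d i : ℕ) : ℝ)) = ((∑ i ∈ I, d i : ℕ) : ℝ) := by push_cast; rfl
    rw [h3]
    exact_mod_cast h2
  · rw [zBMT, if_neg hI, add_zero]
    refine le_trans ?_ (h1.2 I)
    rw [zGram]
    split_ifs <;> simp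

/-- **THEOREM 3.9 with the LITERAL `z_ℱ` (Borinsky–Munch–Tellander 2023): "Even if N[ℱ] ≠ P[z_ℱ], the Newton polytope N[ℱ] is
bounded by the base polytope P[z_ℱ] … We have N[ℱ] ⊂ P[z_ℱ]"** — for `ℱ` built by eq. (polyUF) from ANY symmetric `𝒫` with
vanishing row sums (every regime, generic OR EXCEPTIONAL kinematics) and real masses on a connected edge list, with `z_ℱ(γ) = L_γ +
[ℱ_{G/γ} = 0]` exactly as printed. [cite: BorinskyMunchTellander2023, Theorem 3.9 (main.tex l.855–859) with Theorem 3.5 (l.740–746) and §3.3 (l.715–717)] -/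
theorem newtonPolytope_gramSecondSymanzik_subset_gpPolytope_zBMT (hconn : IsConnectedEdgeList E) (hP : P.IsSymm)
    (hcons : ∀ u, ∑ v, P u v = 0) (m : Fin N → ℝ) :
    NP⟦gramSecondSymanzik E P m⟧ ⊆ gpPolytope (zBMT E P m) :=
  convexHull_min (by
    rintro v ⟨d, hd, rfl⟩
    exact natCast_mem_gpPolytope_zBMT hconn hP hcons hd) (convex_gpPolytope _)

/-- The literal bound refines the combinatorial one: `P[z_ℱ] ⊆ 𝒢_{zGram}` (`zGram ≤ z_ℱ`, equal at `E`).
[cite: BorinskyMunchTellander2023, Theorem 3.9 (main.tex l.855–859); Borinsky2020, Corollary 24 (inclusion part)] -/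
theorem gpPolytope_zBMT_subset_gpPolytope_zGram (hconn : IsConnectedEdgeList E) (hP : P.IsSymm)
    (hcons : ∀ u, ∑ v, P u v = 0) (m : Fin N → ℝ) : gpPolytope (zBMT E P m) ⊆ gpPolytope (zGram E P m) :=
  gpPolytope_mono (fun I => zGram_le_zBMT hP hcons m I) (by rw [zBMT_univ hconn, zGram_univ hconn hP hcons])

end Bound

end Literature.MathematicalPhysics.QuantumFieldTheory.BorinskyMunchTellander2023
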